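import Mathlib
import Summits.Ventures.PercRepro2.Harris
import Summits.Ventures.PercRepro2.BasePrime
import Summits.Ventures.PercRepro2.LocRows
import Summits.Ventures.PercRepro2.SwRow
import Summits.Ventures.PercRepro2.SwOutCube
import Summits.Ventures.PercRepro2.SwOutMixedCubeFarDefs
import Summits.Ventures.PercRepro2.SwOutBigBlockDefs
import Summits.Ventures.PercRepro2.SwOutMixedCore
import Summits.Ventures.PercRepro2.SwOutMixedCorePieces
import Summits.Ventures.PercRepro2.SwOutMixedCoreLower

/-!
# THE CORRECTED ABSTRACT BIG-BLOCK LEMMA (blind cell PercRepro2, night-4 g18, 2026-08-27;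
proofs/NIGHT4-G18.md §2)

Vocabulary in `SwOutMixedCore` (the corrected leak set `Leak'`, `Core`, `Pair`, `G5`, the cubes
`core` / `esc` / `pair`, the projections `projA` / `projB` / `projC`, the transfer lemma
`card_le_of_embed`), `SwOutMixedCorePieces` (the pieces `inA Q` / `inB Q` / `inC` and their
partition of the non-leaking points) and `SwOutMixedCoreLower` (the pieces as finite sets
`SA Q` / `SB Q` / `SC Q` and the lowerness of their images in the three cubes).

This file: each projection is injective on its piece (`injOn_projA` / `_projB` / `_projC`), the
red and blue edge sets of a point of a piece are those of its cube point and of the flipped cube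
point (`ER_eq_core_projA`, `EB_eq_core_projA`, …: `ER` does not see `e`), the block count splits
into the three pieces (`card_split3`), and

**Theorem** `mixedCore_card_le`: for every lower set `Q` of the raw cube `Pt ι κ` satisfying `G5`
and every up-set `𝓔` of atom sets,
`#{p ∈ Q : ¬ Leak' p ∧ ER p ∈ 𝓔} ≤ #{p ∈ Q : ¬ Leak' p ∧ EB p ∈ 𝓔}` —
the rigid counting inequality on the corrected block, for every number of u-arms `ι` and of far
arms `κ` (the census-true statement of NIGHT4-G17.md §4‴ (iii), now a theorem: three cubes); and
its BLOCK-LOWERNESS form `mixedCore_card_le'` (lowerness only between non-leaking points — what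
the geometric moves supply — by passing to the down-closure `downBlock`).
-/

namespace Summit.Ventures.PercRepro2

namespace BigBlock

open scoped Classical

variable {ι κ : Type*} [Fintype ι] [DecidableEq ι] [Fintype κ] [DecidableEq κ]

section Injective

omit [Fintype ι] [DecidableEq ι] [Fintype κ] [DecidableEq κ] in
/-- Points with the same `projA` agree in `s`, `a`, `f`. -/
lemma projA_inj_aux {p q : Pt ι κ} (h : projA p = projA q) :
    p.1 = q.1 ∧ p.2.1 = q.2.1 ∧ p.2.2.2.2 = q.2.2.2.2 :=
  ⟨funext fun j => congrFun h (Sum.inl j), congrFun h (Sum.inr (Sum.inl ())),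
    funext fun k => congrFun h (Sum.inr (Sum.inr k))⟩

omit [Fintype ι] [DecidableEq ι] [Fintype κ] [DecidableEq κ] in
/-- Points with the same `projB` agree in `uP`, `a`, `f`. -/
lemma projB_inj_aux {p q : Pt ι κ} (h : projB p = projB q) :
    p.2.2.1 = q.2.2.1 ∧ p.2.1 = q.2.1 ∧ p.2.2.2.2 = q.2.2.2.2 := by
  refine ⟨?_, congrFun h (Sum.inl 1), funext fun k => congrFun h (Sum.inr k)⟩
  have h0 : (!p.2.2.1) = (!q.2.2.1) := congrFun h (Sum.inl 0)
  have := congrArg (fun b => !b) h0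
  simpa using this

omit [Fintype ι] [DecidableEq ι] [Fintype κ] [DecidableEq κ] in
/-- Points with the same `projC` agree in `a`, `f`. -/
lemma projC_inj_aux {p q : Pt ι κ} (h : projC p = projC q) :
    p.2.1 = q.2.1 ∧ p.2.2.2.2 = q.2.2.2.2 :=
  ⟨congrFun h (Sum.inl ()), funext fun k => congrFun h (Sum.inr k)⟩

variable {Q : Set (Pt ι κ)}

/-- `projA` is injective on piece A. -/
lemma injOn_projA : Set.InjOn projA (SA Q : Set (Pt ι κ)) := by
  intro p hp q hq h
  simp only [SA, Finset.coe_filter, Finset.mem_univ, true_and, Set.mem_setOf_eq] at hp hq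
  obtain ⟨hs, ha, hf⟩ := projA_inj_aux h
  have key : p.2.2.1 = q.2.2.1 ∧ p.2.2.2.1 = q.2.2.2.1 := by
    rcases hp.2 with hC | ⟨hD, he, ha', hn⟩ <;> rcases hq.2 with hC' | ⟨hD', he', ha'', hn'⟩
    · exact ⟨by rw [← hC.1, ← hC'.1]; exact ha,
        by rw [← hC.2, ← hC'.2, ← hC.1, ← hC'.1]; exact ha⟩
    · exfalso
      apply hn'
      have : core (projA q) = p := by
        rw [← h]
        exact (eq_core_projA_of_Core hC).symm
      rw [this]
      exact hp.1
    · exfalso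
      apply hn
      have : core (projA p) = q := by
        rw [h]
        exact (eq_core_projA_of_Core hC').symm
      rw [this]
      exact hq.1
    · exact ⟨by rw [hD.2, hD'.2, he, he'], by rw [he, he']⟩
  exact Prod.ext hs (Prod.ext ha (Prod.ext key.1 (Prod.ext key.2 hf)))

/-- `projB` is injective on piece B. -/
lemma injOn_projB : Set.InjOn projB (SB Q : Set (Pt ι κ)) := by
  intro p hp q hq h
  simp only [SB, Finset.coe_filter, Finset.mem_univ, true_and, Set.mem_setOf_eq] at hp hq
  obtain ⟨hu, ha, hf⟩ := projB_inj_aux h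
  have key : p.1 = q.1 ∧ p.2.2.2.1 = q.2.2.2.1 := by
    rcases hp.2 with ⟨hD, h00, _⟩ | ⟨hP, he⟩ <;> rcases hq.2 with ⟨hD', h00', _⟩ | ⟨hP', he'⟩
    · -- both escaping: `e = !uP`, `s = const e`
      have he : p.2.2.2.1 = q.2.2.2.1 := by
        have h1 : (!p.2.2.1) = (!q.2.2.1) := by rw [hu]
        rwa [hD.2, hD'.2, Bool.not_not, Bool.not_not] at h1
      exact ⟨by rw [hD.1, hD'.1, he], he⟩
    · -- `p` escaping, `q = x̄`: then `p = D00`, excluded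
      exfalso
      apply h00
      have hu' : p.2.2.1 = true := by rw [hu, hP'.2.2, he']
      have he : p.2.2.2.1 = false := by
        have := hD.2
        rw [hu'] at this
        cases hpe : p.2.2.2.1
        · rfl
        · rw [hpe] at this
          exact absurd this (by decide)
      exact ⟨he, by rw [ha, hP'.2.1, he']; rfl⟩
    · exfalso
      apply h00'
      have hu' : q.2.2.1 = true := by rw [← hu, hP.2.2, he]
      have he' : q.2.2.2.1 = false := by
        have := hD'.2
        rw [hu'] at this
        cases hpe : q.2.2.2.1
        · rfl
        · rw [hpe] at this
          exact absurd this (by decide)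
      exact ⟨he', by rw [← ha, hP.2.1, he]; rfl⟩
    · exact ⟨by rw [hP.1, hP'.1, he, he'], by rw [he, he']⟩
  exact Prod.ext key.1 (Prod.ext ha (Prod.ext hu (Prod.ext key.2 hf)))

/-- `projC` is injective on piece C. -/
lemma injOn_projC : Set.InjOn projC (SC Q : Set (Pt ι κ)) := by
  intro p hp q hq h
  simp only [SC, Finset.coe_filter, Finset.mem_univ, true_and, Set.mem_setOf_eq] at hp hq
  obtain ⟨ha, hf⟩ := projC_inj_aux h
  have key : p.1 = q.1 ∧ p.2.2.1 = q.2.2.1 ∧ p.2.2.2.1 = q.2.2.2.1 := by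
    rcases hp.2 with ⟨hP, he⟩ | ⟨hD, he, ha'⟩ <;> rcases hq.2 with ⟨hP', he'⟩ | ⟨hD', he', ha''⟩
    · exact ⟨by rw [hP.1, hP'.1, he, he'], by rw [hP.2.2, hP'.2.2, he, he'], by rw [he, he']⟩
    · exfalso
      have h1 : p.2.1 = true := by rw [hP.2.1, he]; rfl
      rw [ha, ha''] at h1
      exact absurd h1 (by decide)
    · exfalso
      have h1 : q.2.1 = true := by rw [hP'.2.1, he']; rfl
      rw [← ha, ha'] at h1
      exact absurd h1 (by decide)
    · exact ⟨by rw [hD.1, hD'.1, he, he'], by rw [hD.2, hD'.2, he, he'], by rw [he, he']⟩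
  exact Prod.ext key.1 (Prod.ext ha (Prod.ext key.2.1 (Prod.ext key.2.2 hf)))

end Injective

section Profiles

omit [Fintype ι] [DecidableEq ι] [Fintype κ] [DecidableEq κ] in
/-- At a point with `uP = a`, the red set is that of its core-cube point. -/
lemma ER_eq_core_projA {p : Pt ι κ} (hu : p.2.2.1 = p.2.1) : ER p = ER (core (projA p)) := by
  rw [core_projA]
  exact ER_eq_of_eq rfl rfl hu rfl

omit [Fintype ι] [DecidableEq ι] [Fintype κ] [DecidableEq κ] in
/-- At a point with `uP = a`, the blue set is the red set of the flipped core-cube point. -/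
lemma EB_eq_core_projA {p : Pt ι κ} (hu : p.2.2.1 = p.2.1) :
    EB p = ER (core (flipAll (projA p))) := by
  rw [EB, ← flipPt_core, core_projA]
  exact ER_eq_of_eq rfl rfl (by show (!p.2.2.1) = (!p.2.1); rw [hu]) rfl

omit [Fintype ι] [DecidableEq ι] [Fintype κ] [DecidableEq κ] in
/-- At a point with `s = const (!uP)`, the red set is that of its escaping-cube point. -/
lemma ER_eq_esc_projB {p : Pt ι κ} (hs : p.1 = fun _ => !p.2.2.1) : ER p = ER (esc (projB p)) := by
  rw [esc_projB]
  exact ER_eq_of_eq hs rfl rfl rfl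

omit [Fintype ι] [DecidableEq ι] [Fintype κ] [DecidableEq κ] in
/-- At a point with `s = const (!uP)`, the blue set is the red set of the flipped escaping-cube
point. -/
lemma EB_eq_esc_projB {p : Pt ι κ} (hs : p.1 = fun _ => !p.2.2.1) :
    EB p = ER (esc (flipAll (projB p))) := by
  rw [EB, ← flipPt_esc, esc_projB]
  exact ER_eq_of_eq (by show flipAll p.1 = flipAll (fun _ => !p.2.2.1); rw [hs]) rfl rfl rfl

omit [Fintype ι] [DecidableEq ι] [Fintype κ] [DecidableEq κ] in
/-- At a point with `s = const a` and `uP = !a`, the red set is that of its pair-cube point. -/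
lemma ER_eq_pair_projC {p : Pt ι κ} (hs : p.1 = fun _ => p.2.1) (hu : p.2.2.1 = !p.2.1) :
    ER p = ER (pair (projC p)) := by
  rw [pair_projC]
  exact ER_eq_of_eq hs rfl hu rfl

omit [Fintype ι] [DecidableEq ι] [Fintype κ] [DecidableEq κ] in
/-- At a point with `s = const a` and `uP = !a`, the blue set is the red set of the flipped pair-cube
point. -/
lemma EB_eq_pair_projC {p : Pt ι κ} (hs : p.1 = fun _ => p.2.1) (hu : p.2.2.1 = !p.2.1) :
    EB p = ER (pair (flipAll (projC p))) := by
  rw [EB, ← flipPt_pair, pair_projC]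
  exact ER_eq_of_eq (by show flipAll p.1 = flipAll (fun _ => p.2.1); rw [hs]) rfl
    (by show (!p.2.2.1) = (!(!p.2.1)); rw [hu]) rfl

variable {Q : Set (Pt ι κ)}

/-- On piece A, `uP = a`. -/
lemma uP_eq_a_of_mem_SA {p : Pt ι κ} (hp : p ∈ SA Q) : p.2.2.1 = p.2.1 := by
  rw [mem_SA] at hp
  rcases hp.2 with hC | ⟨hD, he, ha, _⟩
  · exact hC.1.symm
  · rw [hD.2, he, ha]
    rfl

/-- On piece B, `s = const (!uP)`. -/
lemma s_eq_of_mem_SB {p : Pt ι κ} (hp : p ∈ SB Q) : p.1 = fun _ => !p.2.2.1 := by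
  rw [mem_SB] at hp
  rcases hp.2 with ⟨hD, _, _⟩ | ⟨hP, he⟩
  · rw [hD.1]
    funext _
    rw [hD.2, Bool.not_not]
  · rw [hP.1]
    funext _
    rw [hP.2.2, he]

/-- On piece C, `s = const a` and `uP = !a`. -/
lemma s_uP_of_mem_SC {p : Pt ι κ} (hp : p ∈ SC Q) :
    p.1 = (fun _ => p.2.1) ∧ p.2.2.1 = !p.2.1 := by
  rw [mem_SC] at hp
  rcases hp.2 with ⟨hP, he⟩ | ⟨hD, he, ha⟩
  · refine ⟨?_, ?_⟩
    · rw [hP.1, hP.2.1]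
    · rw [hP.2.2, hP.2.1, he]
      rfl
  · refine ⟨?_, ?_⟩
    · rw [hD.1, he, ha]
    · rw [hD.2, he, ha]

end Profiles

section Counting

variable (Q : Set (Pt ι κ))

/-- A count over the non-leaking points of `Q` splits into the three pieces. -/
lemma card_split3 (R : Pt ι κ → Prop) :
    (Finset.univ.filter fun p => p ∈ Q ∧ ¬ Leak' p ∧ R p).card =
      ((SA Q).filter R).card + (((SB Q).filter R).card + ((SC Q).filter R).card) := by
  rw [← Finset.card_union_of_disjoint, ← Finset.card_union_of_disjoint]
  · congr 1
    ext p
    simp only [Finset.mem_filter, Finset.mem_univ, true_and, Finset.mem_union, mem_SA, mem_SB,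
      mem_SC]
    constructor
    · rintro ⟨hQ, hL, hR⟩
      rcases inA_or_inB_or_inC (Q := Q) hL with h | h | h
      · exact Or.inl ⟨⟨hQ, h⟩, hR⟩
      · exact Or.inr (Or.inl ⟨⟨hQ, h⟩, hR⟩)
      · exact Or.inr (Or.inr ⟨⟨hQ, h⟩, hR⟩)
    · rintro (⟨⟨hQ, h⟩, hR⟩ | ⟨⟨hQ, h⟩, hR⟩ | ⟨⟨hQ, h⟩, hR⟩)
      · exact ⟨hQ, not_leak'_of_inA h, hR⟩
      · exact ⟨hQ, not_leak'_of_inB h, hR⟩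
      · exact ⟨hQ, not_leak'_of_inC h, hR⟩
  · rw [Finset.disjoint_left]
    intro p hp hp'
    rw [Finset.mem_filter, mem_SA] at hp
    rw [Finset.mem_union, Finset.mem_filter, Finset.mem_filter, mem_SB, mem_SC] at hp'
    rcases hp' with hp' | hp'
    · exact not_inA_and_inB ⟨hp.1.2, hp'.1.2⟩
    · exact not_inA_and_inC ⟨hp.1.2, hp'.1.2⟩
  · rw [Finset.disjoint_left]
    intro p hp hp'
    rw [Finset.mem_filter, mem_SB] at hp
    rw [Finset.mem_filter, mem_SC] at hp'
    exact not_inB_and_inC ⟨hp.1.2, hp'.1.2⟩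

variable {Q}

/-- **THE CORRECTED ABSTRACT BIG-BLOCK LEMMA**: for every lower set `Q` of the raw cube with `G5`
and every up-set `𝓔` of atom sets, the non-leaking (`Leak'`) part of `Q` satisfies the rigid
counting inequality.  Proof: the block is three cubes (`card_split3`), each a lower set of its cube
(`isLowerSet_image_projA` / `_projB` / `_projC`), and the cube principle applies to each
(`card_le_of_embed`). -/
theorem mixedCore_card_le (hQ : IsLowerSet Q) (hG : G5 Q) {𝓔 : Set (Set (Atom ι κ))}
    (h𝓔 : IsUpperSet 𝓔) :
    (Finset.univ.filter fun p : Pt ι κ => p ∈ Q ∧ ¬ Leak' p ∧ ER p ∈ 𝓔).card ≤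
      (Finset.univ.filter fun p : Pt ι κ => p ∈ Q ∧ ¬ Leak' p ∧ EB p ∈ 𝓔).card := by
  have e1 := card_split3 Q (fun p => ER p ∈ 𝓔)
  have e2 := card_split3 Q (fun p => EB p ∈ 𝓔)
  beta_reduce at e1 e2
  rw [e1, e2]
  refine add_le_add ?_ (add_le_add ?_ ?_)
  · exact card_le_of_embed (SA Q) projA injOn_projA (fun x => ER (core x))
      (fun _ _ h => ER_mono (core_mono h))
      (fun p hp => ER_eq_core_projA (uP_eq_a_of_mem_SA hp))
      (fun p hp => EB_eq_core_projA (uP_eq_a_of_mem_SA hp)) (isLowerSet_image_projA hQ) h𝓔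
  · exact card_le_of_embed (SB Q) projB injOn_projB (fun y => ER (esc y))
      (fun _ _ h => ER_esc_mono h)
      (fun p hp => ER_eq_esc_projB (s_eq_of_mem_SB hp))
      (fun p hp => EB_eq_esc_projB (s_eq_of_mem_SB hp)) (isLowerSet_image_projB hQ hG) h𝓔
  · exact card_le_of_embed (SC Q) projC injOn_projC (fun z => ER (pair z))
      (fun _ _ h => ER_pair_mono h)
      (fun p hp => ER_eq_pair_projC (s_uP_of_mem_SC hp).1 (s_uP_of_mem_SC hp).2)
      (fun p hp => EB_eq_pair_projC (s_uP_of_mem_SC hp).1 (s_uP_of_mem_SC hp).2)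
      (isLowerSet_image_projC hQ hG) h𝓔

end Counting

section BlockLower

variable (Q : Set (Pt ι κ))

/-- Lowerness ON THE BLOCK ONLY: `q ≤ p` with both non-leaking and `p ∈ Q` gives `q ∈ Q` (what the
geometric chain supplies: the moves between class points). -/
def BlockLower : Prop := ∀ p q, ¬ Leak' p → ¬ Leak' q → q ≤ p → p ∈ Q → q ∈ Q

/-- The down-closure of the non-leaking part of `Q`. -/
def downBlock : Set (Pt ι κ) := {q | ∃ p, p ∈ Q ∧ ¬ Leak' p ∧ q ≤ p}

variable {Q}

omit [Fintype ι] [DecidableEq ι] [Fintype κ] [DecidableEq κ] in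
/-- A lower set of the cube is block-lower. -/
lemma BlockLower.of_isLowerSet (hQ : IsLowerSet Q) : BlockLower Q :=
  fun _ _ _ _ hle hp => hQ hle hp

omit [Fintype ι] [DecidableEq ι] [Fintype κ] [DecidableEq κ] in
/-- The down-closure is a lower set. -/
lemma isLowerSet_downBlock : IsLowerSet (downBlock Q) := by
  rintro q q' hle ⟨p, hp, hL, hqp⟩
  exact ⟨p, hp, hL, le_trans hle hqp⟩

omit [Fintype ι] [DecidableEq ι] [Fintype κ] [DecidableEq κ] in
/-- On the non-leaking points, the down-closure of a block-lower `Q` is `Q`. -/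
lemma mem_downBlock_iff (hQ : BlockLower Q) {q : Pt ι κ} (hq : ¬ Leak' q) :
    q ∈ downBlock Q ↔ q ∈ Q := by
  constructor
  · rintro ⟨p, hp, hL, hqp⟩
    exact hQ p q hL hq hqp hp
  · intro h
    exact ⟨q, h, hq, le_rfl⟩

omit [Fintype ι] [DecidableEq ι] [Fintype κ] [DecidableEq κ] in
/-- The two points of a `G5` instance are non-leaking. -/
lemma not_leak'_G5_src (a e : Bool) (f : Config κ) :
    ¬ Leak' (((fun _ => true) : Config ι), a, false, e, f) := by
  rw [not_leak'_iff]
  cases a <;> cases e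
  · exact Or.inl ⟨rfl, rfl⟩
  · exact Or.inr (Or.inl ⟨rfl, rfl⟩)
  · exact Or.inr (Or.inr ⟨rfl, rfl, rfl⟩)
  · exact Or.inr (Or.inl ⟨rfl, rfl⟩)

omit [Fintype ι] [DecidableEq ι] [Fintype κ] [DecidableEq κ] in
/-- The two points of a `G5` instance are non-leaking. -/
lemma not_leak'_G5_tgt (a e : Bool) (f : Config κ) :
    ¬ Leak' (((fun _ => false) : Config ι), a, true, e, f) := by
  rw [not_leak'_iff]
  cases a <;> cases e
  · exact Or.inr (Or.inl ⟨rfl, rfl⟩)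
  · exact Or.inr (Or.inr ⟨rfl, rfl, rfl⟩)
  · exact Or.inr (Or.inl ⟨rfl, rfl⟩)
  · exact Or.inl ⟨rfl, rfl⟩

omit [Fintype ι] [DecidableEq ι] [Fintype κ] [DecidableEq κ] in
/-- `G5` passes to the down-closure. -/
lemma G5_downBlock (hQ : BlockLower Q) (hG : G5 Q) : G5 (downBlock Q) := by
  intro a e f h
  rw [mem_downBlock_iff hQ (not_leak'_G5_src a e f)] at h
  rw [mem_downBlock_iff hQ (not_leak'_G5_tgt a e f)]
  exact hG a e f h

/-- **THE CORRECTED ABSTRACT BIG-BLOCK LEMMA, block-lowerness form**: lowerness is only needed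
between non-leaking points (apply `mixedCore_card_le` to the down-closure). -/
theorem mixedCore_card_le' (hQ : BlockLower Q) (hG : G5 Q) {𝓔 : Set (Set (Atom ι κ))}
    (h𝓔 : IsUpperSet 𝓔) :
    (Finset.univ.filter fun p : Pt ι κ => p ∈ Q ∧ ¬ Leak' p ∧ ER p ∈ 𝓔).card ≤
      (Finset.univ.filter fun p : Pt ι κ => p ∈ Q ∧ ¬ Leak' p ∧ EB p ∈ 𝓔).card := by
  have key := mixedCore_card_le (isLowerSet_downBlock (Q := Q)) (G5_downBlock hQ hG) h𝓔
  have e1 : ∀ R : Pt ι κ → Prop,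
      (Finset.univ.filter fun p : Pt ι κ => p ∈ downBlock Q ∧ ¬ Leak' p ∧ R p) =
        (Finset.univ.filter fun p : Pt ι κ => p ∈ Q ∧ ¬ Leak' p ∧ R p) := by
    intro R
    apply Finset.filter_congr
    intro p _
    constructor
    · rintro ⟨h1, h2, h3⟩
      exact ⟨(mem_downBlock_iff hQ h2).1 h1, h2, h3⟩
    · rintro ⟨h1, h2, h3⟩
      exact ⟨(mem_downBlock_iff hQ h2).2 h1, h2, h3⟩
  rw [e1 (fun p => ER p ∈ 𝓔), e1 (fun p => EB p ∈ 𝓔)] at key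
  exact key

end BlockLower

end BigBlock

end Summit.Ventures.PercRepro2
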